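import Summits.QuantumFields.YangMills.Theses.BalabanUVNodes
import Summits.QuantumFields.YangMills.Theorems.BalabanUVNodesN27AtRecord11
import Summits.QuantumFields.YangMills.Theorems.BalabanUVNodesN27AtRecord11Keyed

/-!
# BalabanUVNodes ∕ N27 = binder B5 AT THE RECORD, XXI — THE ROUTE-FACING FACES OF THE REV-1 ITEM K3 `Theses.BalabanUVNodes.SpineGivenEndpointR11`
# (stmt-QuantumFields-19676; route rev 6, restated at NODE 00's Stage-11 record 2026-08-26): the item IS `Spine ₁₁C` at `N = 2` (module XX §4), hence follows
# from `Spine ₅C`, from B5 at any record predicate coarser than ₅C, and — the ONE discharge-SHAPED knit of the composite node — from the seven K4 stubs and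
# K5 in the rev-1 shape (N27x · N20 · N21 · the N19′ ∃δ-edge) BY NAME at (₁₁C, `SRec`, `RRec`), or from the three children's reading predicates (XV); faithfulness:
# the item IS cluster K5 unguarded at ₁₁C, and is insensitive to the carrier pins of the record
# (cell `pub-ymgap`, HUMAN RULING D-0062 Track A, R134 seat `pub-ymgap-dag-n27-c` (s2); `--supports stmt-QuantumFields-19676`; count-neutral)

WHY.  The route's rev-1 deciding theorem `Theses.BalabanUVNodes.closes` consumes K3 as `h3 F D w hR hb hend` at a Stage-11 record pair of `SU(2)` data (RIDER №7: NODE 00 is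
`N`-generic, the route instantiates `F 2`).  Modules XII–XX type binder B5 = `Spine Rec` over a PARAMETER `Rec` at generic `N` and never import the route file; THIS FILE is the
thin route-facing layer at `N = 2`: every theorem below is ONE application of a module-XX ∕ XII ∕ XIV ∕ XV theorem BY NAME, with the item's name in the conclusion, so that the
day the children land at the ₁₁ record the item closes by `spineGivenEndpointR11_of_rateStubs_coreEdge …` (or `_of_readings`) in one line.

THE FIELD-BY-FIELD TABLE OF THE KNIT (hypotheses of `spineGivenEndpointR11_of_rateStubs_coreEdge` ↦ fields of `T4MatchingAssembly.HybridNE7` per string; module XX's header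
has the same table with the tree producers): `weight` ← `h20 : S_N20 SRec` (N20 = NE7b) · `shell` ← `h21 : S_N21 SRec` (N21 = NE7c) · `core` + `summable` ← `h19` = the N19′ ∃δ-edge at
the spine AND rate carriers, fed by K4 = `h14 h15 h16 h17 h18 h22` (N14 NE1′ · N15 NE2 · N16 NE3 · N17 NE4 · N18 NE5 · N22 NE9 at `RRec`) with existence `hx : S_R00x ₁₁C RRec` ·
`lt_one` ← derived in the tail (XII `spineDatum_of_tail`), never asked · `0 < l₀`, `0 < vol`, `K₀`, E1∕E2 ← `hx' : S_N27x ₁₁C SRec`.  `SRec` ∕ `RRec` PARAMETRIC (no rate-record home keyed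
to `Record11` in the tree today).

WHAT IS KERNEL-CHECKED ([bookkeeping]; 0 `def`, 0 `sorry`; `N = 2` throughout = the route's instantiation, not a toy).
* §1 `spineGivenEndpointR11_iff_spine_rec11C` (THE ITEM ↔ `Spine ₁₁C`, XX `k3Shape_iff_spine_rec11C`; definitional unfolding of the route decl) · `spineGivenEndpointR11_of_spine_rec5C`
  (XX §1) · `spineGivenEndpointR11_of_coarser` (XX §1′, tower road) · `spineGivenEndpointR11_iff_spine_rec11CB10YZWB8` (the item is insensitive to the five carrier pins, XX §2).
* §2 **`spineGivenEndpointR11_of_rateStubs_coreEdge`** (K3 from the seven K4 stubs + N27x · N20 · N21 · N19′ at (₁₁C, `SRec`, `RRec`); XX §3 ∘ XIV) · `…_glueN17` (N17 GLUED from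
  (D4) · N18 · N22) · `…_rec5C` (the stubs keyed at ₅C) · `spineGivenEndpointR11_of_readings` (from XV's three reading predicates at ₁₁C).
* §3 FAITHFULNESS: `spineGivenEndpointR11_iff_spineMatching_true` — the item IS cluster K5 «SpineMatching ₁₁C ⊤» (XII `spine_iff_spineMatching_true`): per string under the prefix,
  N20 ∧ N21 ∧ N19-on-cores ∧ `Summable δ` ∧ E1∕E2 at some carriers — nothing smuggled, nothing lost.
* §4 (v1.1) CLUSTER LEVEL: `spineGivenEndpointR11_of_spineRates_spineMatching` (K4 hook + K5 `SpineMatching ₁₁C Inputs` ⇒ the item, the route module's glue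
  `YMDAG.UVSplit.B5_at_record` BY NAME) · `spineGivenEndpointR11_of_K5stubs` (the route module's verbatim K5 stub list incl. `S_N19 SRec Inputs`, `S_U4 SRec`, via `SpineMatching_of`).
* §5 (v1.2) KEYED AT NODE 00's STAGE-11 TUPLES (module XXII by name): `spineGivenEndpointR11_iff_forall_datumOfRecord₁₁` — THE ITEM ⟺ «B5 at `datumOfRecord₁₁ F 2 θ hP` for every
  admissible `θ` with provisos» (worlds eliminated) · `spineGivenEndpointR11_of_keyed₁₁` (the item from the children's estimates keyed by readings `cr`∕`rr` off the tuples, XXII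
  `spine_rec11C_of_keyed₁₁`).
* §6 (v1.3) THE TWO-KEY JUNCTION at `N = 2` (XXII §4 by name): `spineGivenEndpointR11_of_rateStubs_twoKeys₁₁` — the item from the (T-SPINE)∕(T-RATE) one-application stub instances at
  SEPARATELY keyed `SRec`∕`RRec` + the N19′ edge for every pair of tuples with the same datum.

HONEST FRAMING.  COMPOSITE-node bookkeeping: every K4–K5 stub ∕ reading ∕ `Spine ₅C` premise is a HYPOTHESIS with NO producer at any record today (0∕1) — GAP-STATED, located at
the children N14–N22 ∕ N27x ∕ R00x; the item K3 is NOT proved here and NOT claimed; inhabitation of ₁₁C at `N = 2` is K0 (stmt-QuantumFields-19673, open); (B) and END are the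
item's antecedents, used only by modus ponens inside B5 (never refuted, no ex falso); nothing of Bałaban's is instantiated or asserted; NO node is discharged; typed 28∕28, the
discharged count is not touched; one finite four-torus programme at fixed ε — NOT ℝ⁴, NOT infinite volume, NOT OS, NOT a mass gap, NOT Clay.  Route-facing (imports the route file
rev 6; the N-generic content lives in module XX, restate-immune).  No decl below carries a cite tag.
-/

namespace Summit.QuantumFields.YangMills.Theorems.BalabanUVNodesN27SpineRecord

open Literature.MathematicalPhysics.QuantumFieldTheory.Balaban1983to89
open Literature.MathematicalPhysics.QuantumFieldTheory.Balaban1983to89.T4Continuum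
open Summit.QuantumFields.BalabanUV.T4Continuum.Spine
open Summit.QuantumFields.YangMills.Theses.BalabanUVNodes (SpineGivenEndpointR11)
open YMDAG.UVSplit

/-! ## §1 The item IS `Spine ₁₁C` at `N = 2`; the ₅C ∕ coarser-record ∕ carrier-pinned faces -/

section ItemFaces

/-- **THE REV-1 ITEM K3 IS BINDER B5 AT THE STAGE-11 RECORD, `N = 2`**: `SpineGivenEndpointR11 ↔ Spine ₁₁C` — the route decl displays (B) and END, which are B5's own
antecedents (XX `k3Shape_iff_spine_rec11C`; the decl unfolds definitionally). [bookkeeping] -/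
theorem spineGivenEndpointR11_iff_spine_rec11C :
    SpineGivenEndpointR11 ↔ Spine (N := 2) fun F D w => Node00.IsRecordOfRecord₁₁C F 2 D w :=
  k3Shape_iff_spine_rec11C (N := 2)

/-- `Spine ₁₁C` at `N = 2` gives the item. [bookkeeping] -/
theorem spineGivenEndpointR11_of_spine_rec11C (h : Spine (N := 2) fun F D w => Node00.IsRecordOfRecord₁₁C F 2 D w) : SpineGivenEndpointR11 :=
  spineGivenEndpointR11_iff_spine_rec11C.mpr h

/-- The item gives `Spine ₁₁C` at `N = 2` (nothing beyond B5 at the record is in it). [bookkeeping] -/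
theorem spine_rec11C_of_spineGivenEndpointR11 (h : SpineGivenEndpointR11) : Spine (N := 2) fun F D w => Node00.IsRecordOfRecord₁₁C F 2 D w :=
  spineGivenEndpointR11_iff_spine_rec11C.mp h

/-- **THE ITEM FROM `Spine` AT THE STAGE-5 RECORD PREDICATE** (`N = 2`): XX `spine_rec11C_of_spine_rec5C` (shadow road).  The premise has NO producer today (N19 ∕ N20 ∕ N21 ∕
N27x 0∕1 at every record). [bookkeeping] -/
theorem spineGivenEndpointR11_of_spine_rec5C (h₅ : Spine (N := 2) fun F D w => Node00.IsRecordOfRecord₅C F 2 D w) : SpineGivenEndpointR11 :=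
  spineGivenEndpointR11_of_spine_rec11C (spine_rec11C_of_spine_rec5C h₅)

/-- The item from B5 at ANY record predicate coarser than ₅C (`N = 2`; XX `spine_rec11C_of_coarser`, tower road). [bookkeeping] -/
theorem spineGivenEndpointR11_of_coarser {Rec : RecordPred 2}
    (hle : ∀ (F : T4Family) (D : Datum F 2) (w : DagBinding.WorldP), Node00.IsRecordOfRecord₅C F 2 D w → Rec F D w) (h : Spine Rec) :
    SpineGivenEndpointR11 :=
  spineGivenEndpointR11_of_spine_rec11C (spine_rec11C_of_coarser hle h)

/-- **THE ITEM IS INSENSITIVE TO THE CARRIER PINS OF THE RECORD**: `SpineGivenEndpointR11 ↔ Spine ₁₁CB10YZWB8` at `N = 2` — B5 at the plain Stage-11 records ⟺ B5 at the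
fully pinned ones (XX `spine_rec11C_iff_spine_rec11CB10YZWB8`: B5 reads the datum, the pins re-bind only the world). [bookkeeping] -/
theorem spineGivenEndpointR11_iff_spine_rec11CB10YZWB8 :
    SpineGivenEndpointR11 ↔ Spine (N := 2) fun F D w => Node00.IsRecordOfRecord₁₁CB10YZWB8 F 2 D w :=
  spineGivenEndpointR11_iff_spine_rec11C.trans spine_rec11C_iff_spine_rec11CB10YZWB8

end ItemFaces

/-! ## §2 THE DISCHARGE-SHAPED KNIT: the item from the K4 stubs and K5 in the rev-1 shape, BY NAME (every stub a hypothesis; `SRec`, `RRec` parametric) -/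

section Knit

variable (SRec : SpineRecordPred 2) (RRec : RateRecordPred 2)

/-- **K3 `SpineGivenEndpointR11` FROM THE SEVEN K4 STUBS AND THE REV-1 K5, BY NAME** (`N = 2`): R00x (rate carriers of record exist under the pins, at ₁₁C) · N14 NE1′ · N15 NE2 ·
N16 NE3 · N17 NE4 · N18 NE5 · N22 NE9 at the rate carriers `RRec` · N27x (the expansion of record exists under the pins, E1∕E2, at ₁₁C) · N20 NE7b · N21 NE7c at the spine carriers
`SRec` · the N19′ ∃δ-edge «`SRec … S → RRec … R → RatesAt D R → ∃ δ, Spine.NE7.Core … δ ∧ Summable δ`» ⇒ the item (XX `spine_rec11C_of_rateStubs_coreEdge` ∘ §1).  Every stub is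
a HYPOTHESIS in the term (0∕1 today); no budget clause, no `S.δ`, U4′ retired. [bookkeeping] -/
theorem spineGivenEndpointR11_of_rateStubs_coreEdge
    (hx : S_R00x (fun F D w => Node00.IsRecordOfRecord₁₁C F 2 D w) RRec) (h14 : S_N14 RRec) (h15 : S_N15 RRec) (h16 : S_N16 RRec)
    (h17 : S_N17 RRec) (h18 : S_N18 RRec) (h22 : S_N22 RRec) (hx' : S_N27x (fun F D w => Node00.IsRecordOfRecord₁₁C F 2 D w) SRec)
    (h20 : S_N20 SRec) (h21 : S_N21 SRec)
    (h19 : ∀ (F : T4Family) (D : Datum F 2) (g₀ : ℕ → ℝ) (os : List (ULoop F)) (S : SpineCarriers) (R : RateCarriers 2),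
      SRec F D g₀ os S → RRec F D g₀ os R → RatesAt D R → letI := S.dec
        ∃ δ : ℕ → ℝ, NE7.Core S.l₀ S.vol S.T S.Bad (fun K t τ => S.A K t τ - S.shA K t τ) (fun K t τ => S.B K t τ - S.shB K t τ) δ ∧
          Summable δ) :
    SpineGivenEndpointR11 :=
  spineGivenEndpointR11_of_spine_rec11C (spine_rec11C_of_rateStubs_coreEdge SRec RRec hx h14 h15 h16 h17 h18 h22 hx' h20 h21 h19)

/-- The same with N17 GLUED from (D4) · N18 · N22 (`N17_of_U3edge`; XX `spine_rec11C_of_rateStubs_coreEdge_glueN17`). [bookkeeping] -/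
theorem spineGivenEndpointR11_of_rateStubs_coreEdge_glueN17
    (hx : S_R00x (fun F D w => Node00.IsRecordOfRecord₁₁C F 2 D w) RRec) (h14 : S_N14 RRec) (h15 : S_N15 RRec) (h16 : S_N16 RRec)
    (h18 : S_N18 RRec) (h22 : S_N22 RRec) (hD4 : S_D4 RRec) (hx' : S_N27x (fun F D w => Node00.IsRecordOfRecord₁₁C F 2 D w) SRec)
    (h20 : S_N20 SRec) (h21 : S_N21 SRec)
    (h19 : ∀ (F : T4Family) (D : Datum F 2) (g₀ : ℕ → ℝ) (os : List (ULoop F)) (S : SpineCarriers) (R : RateCarriers 2),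
      SRec F D g₀ os S → RRec F D g₀ os R → RatesAt D R → letI := S.dec
        ∃ δ : ℕ → ℝ, NE7.Core S.l₀ S.vol S.T S.Bad (fun K t τ => S.A K t τ - S.shA K t τ) (fun K t τ => S.B K t τ - S.shB K t τ) δ ∧
          Summable δ) :
    SpineGivenEndpointR11 :=
  spineGivenEndpointR11_of_spine_rec11C (spine_rec11C_of_rateStubs_coreEdge_glueN17 SRec RRec hx h14 h15 h16 h18 h22 hD4 hx' h20 h21 h19)

/-- **THE SAME STUBS KEYED AT THE STAGE-5 RECORD ⇒ THE ITEM** (`N = 2`): XIV's join gives `Spine ₅C`, XX §1's closer carries it to ₁₁C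
(XX `spine_rec11C_of_rateStubs_coreEdge_rec5C`). [bookkeeping] -/
theorem spineGivenEndpointR11_of_rateStubs_coreEdge_rec5C
    (hx : S_R00x (fun F D w => Node00.IsRecordOfRecord₅C F 2 D w) RRec) (h14 : S_N14 RRec) (h15 : S_N15 RRec) (h16 : S_N16 RRec)
    (h17 : S_N17 RRec) (h18 : S_N18 RRec) (h22 : S_N22 RRec) (hx' : S_N27x (fun F D w => Node00.IsRecordOfRecord₅C F 2 D w) SRec)
    (h20 : S_N20 SRec) (h21 : S_N21 SRec)
    (h19 : ∀ (F : T4Family) (D : Datum F 2) (g₀ : ℕ → ℝ) (os : List (ULoop F)) (S : SpineCarriers) (R : RateCarriers 2),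
      SRec F D g₀ os S → RRec F D g₀ os R → RatesAt D R → letI := S.dec
        ∃ δ : ℕ → ℝ, NE7.Core S.l₀ S.vol S.T S.Bad (fun K t τ => S.A K t τ - S.shA K t τ) (fun K t τ => S.B K t τ - S.shB K t τ) δ ∧
          Summable δ) :
    SpineGivenEndpointR11 :=
  spineGivenEndpointR11_of_spine_rec11C (spine_rec11C_of_rateStubs_coreEdge_rec5C SRec RRec hx h14 h15 h16 h17 h18 h22 hx' h20 h21 h19)

end Knit

section KnitReadings

open T4OutputRate T4RecentScale T4GoodClassBudget T4CauchySum T4TowerRateComposition T4TowerRateDischarge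
open T4EtaRateMin (Readings NE3Shape)
open T4RateLiaison (GaugeDominated)
open T4ShellMeasure (SlotLedger)
open Summit.QuantumFields.BalabanUV.T4Continuum.NE7b.PinnedExtraction (ExtractionLaws)
open Summit.QuantumFields.YangMills.BalabanUVNodes.N19LedgerLinkSync (LedgerDataSync LedgerAtSync)

variable (SRec : SpineRecordPred 2) (Inputs : InputsPred 2)

/-- **THE ITEM FROM THE CHILDREN'S READING PREDICATES** (`N = 2`; XX `spine_rec11C_of_readings` ∘ §1): the extraction stub `S_N27x ₁₁C SRec`, the N20 reading (two runs'
extraction laws + the count), the N21 reading (two slot ledgers under one geometric majorant), the N19 reading (the `LedgerAtSync` package with the in-edges BY NAME, pin-free)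
and K4's hook `SpineRates ₁₁C Inputs` ⇒ `SpineGivenEndpointR11`. [bookkeeping] -/
theorem spineGivenEndpointR11_of_readings (hx : S_N27x (fun F D w => Node00.IsRecordOfRecord₁₁C F 2 D w) SRec)
    (hread20 : ∀ (F : T4Family) (D : Datum F 2) (g₀ : ℕ → ℝ) (os : List (ULoop F)) (S : SpineCarriers), SRec F D g₀ os S →
      ∃ (α α' : Type) (X : ℕ → Finset α) (Badx : ℕ → α → Finset S.ι) (q : ℕ → α → ℝ)
        (X' : ℕ → Finset α') (Badx' : ℕ → α' → Finset S.ι) (q' : ℕ → α' → ℝ),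
        ExtractionLaws S.l₀ S.T S.A S.Bad X Badx q ∧ ExtractionLaws S.l₀ S.T S.B S.Bad X' Badx' q' ∧
        (∀ (K : ℕ) (t : ℝ), |t| ≤ S.l₀ → ∀ τ, 0 ≤ S.A K t τ) ∧ (∀ (K : ℕ) (t : ℝ), |t| ≤ S.l₀ → ∀ τ, 0 ≤ S.B K t τ) ∧
        (∀ K, ∑ x ∈ X K, q K x ≤ S.W K) ∧ (∀ K, ∑ x ∈ X' K, q' K x ≤ S.W K) ∧ (∀ K, S.W K < 1) ∧ Summable S.W)
    (hread21 : ∀ (F : T4Family) (D : Datum F 2) (g₀ : ℕ → ℝ) (os : List (ULoop F)) (S : SpineCarriers), SRec F D g₀ os S →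
      ∃ (σA σB : Type) (SA : ℕ → Finset σA) (SB : ℕ → Finset σB) (pieceA : ℕ → ℝ → σA → S.ι → ℝ)
        (pieceB : ℕ → ℝ → σB → S.ι → ℝ) (cA : ℕ → σA → ℝ) (cB : ℕ → σB → ℝ) (C ϑ : ℝ),
        SlotLedger S.l₀ S.T S.A S.shA SA pieceA cA ∧ SlotLedger S.l₀ S.T S.B S.shB SB pieceB cB ∧
        0 ≤ ϑ ∧ ϑ < 1 ∧ (∀ K, ∑ s ∈ SA K, cA K s ≤ C * ϑ ^ K) ∧ (∀ K, ∑ s ∈ SB K, cB K s ≤ C * ϑ ^ K) ∧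
        (∀ K, ∑ s ∈ SA K, cA K s + ∑ s ∈ SB K, cB K s ≤ S.Wsh K) ∧ Summable S.Wsh)
    (hread19 : ∀ (F : T4Family) (D : Datum F 2) (g₀ : ℕ → ℝ) (os : List (ULoop F)) (S : SpineCarriers),
      SRec F D g₀ os S → Inputs F D g₀ os → letI := S.dec
      ∃ (C : Carriers) (_ : DecidableEq C.Dom) (F' : Type) (ι' X' : Type) (_ : MeasurableSpace ι')
        (L : LedgerDataSync C F' ι' S.ι) (R : Readings ι' X') (W : Set (ℕ → ℝ)) (EA : Functional C C.BgA)
        (EB : Functional C C.BgB) (κ θ₅ C₅ C₉ ω θc Cd γ C₃ θ₃ Pg : ℝ) (q : ℕ) (Λm : ℕ → ℕ → ℝ)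
        (CU : (ℕ → ℝ) → ℕ → ℝ) (g : ℕ → ℕ → ℝ) (uA : ℕ → ι' → C.BgA) (uB : ℕ → ι' → C.BgB),
        LedgerAtSync L S.l₀ S.vol S.T S.Bad (fun K t τ => S.A K t τ - S.shA K t τ) (fun K t τ => S.B K t τ - S.shB K t τ)
          R EA EB κ g uA uB ω θc θ₅ θ₃ ∧
        NE3Shape R C₃ θ₃ ∧ 0 ≤ C₃ ∧ GaugeDominated R uA uB ∧
        NE5 EA EB W κ θ₅ C₅ ∧ 0 ≤ θ₅ ∧ 0 ≤ C₅ ∧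
        (NE9 EA W κ Λm ∧ T4OutputRate.FadingMemory C₉ ω Λm) ∧ 0 ≤ ω ∧
        InjectedRate Cd 0 θc (fun K j => T4CouplingMatching.disc (g K) (g (K + 1)) j) ∧ 0 ≤ Cd ∧ 0 ≤ θc ∧
        (∀ K i, i ≤ K → 0 < g K i ∧ g K i ≤ γ) ∧
        LipBackground EA W κ CU ∧ PolyLipGrowth CU g Pg q ∧ 0 ≤ Pg ∧
        (∀ K, g K ∈ W) ∧ (∀ K, (fun i => g (K + 1) (i + 1)) ∈ W))
    (h4 : SpineRates (fun F D w => Node00.IsRecordOfRecord₁₁C F 2 D w) Inputs) :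
    SpineGivenEndpointR11 :=
  spineGivenEndpointR11_of_spine_rec11C (spine_rec11C_of_readings SRec Inputs hx hread20 hread21 hread19 h4)

end KnitReadings

/-! ## §3 FAITHFULNESS: the item IS cluster K5 unguarded at ₁₁C -/

section Faithful

/-- **`SpineGivenEndpointR11 ↔ SpineMatching ₁₁C ⊤`** (`N = 2`): the item is EQUIVALENT to cluster K5 «SpineMatching» at the Stage-11 record with K4's conclusion set to
`True` — per string under the prefix (B) ∧ END ∧ small tuned couplings: N20 ∧ N21 ∧ N19-on-cores ∧ `Summable δ` ∧ E1∕E2 at some carriers (budget clause derived), and nothing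
else (XII `spine_iff_spineMatching_true`).  Nothing smuggled into the item, nothing lost. [bookkeeping] -/
theorem spineGivenEndpointR11_iff_spineMatching_true :
    SpineGivenEndpointR11 ↔ SpineMatching (N := 2) (fun F D w => Node00.IsRecordOfRecord₁₁C F 2 D w) fun _ _ _ _ => True :=
  spineGivenEndpointR11_iff_spine_rec11C.trans (spine_iff_spineMatching_true _)

end Faithful

/-! ## §4 (v1.1, append-only) THE CLUSTER-LEVEL FACE: the item from K4 «SpineRates» and K5 «SpineMatching» at ₁₁C — the route module's glue `B5_at_record` BY NAME
(the shape a BC3 skeleton `SpineGivenEndpointR11_of` keyed to N27's glue reads; a K5-cluster producer at the Stage-11 record closes the item in ONE application) -/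

section ClusterLevel

variable (Inputs : InputsPred 2) (SRec : SpineRecordPred 2)

/-- **THE ITEM FROM THE TWO CLUSTER STATEMENTS AT THE STAGE-11 RECORD** (`N = 2`): K4's hook `SpineRates ₁₁C Inputs` and K5 `SpineMatching ₁₁C Inputs` give
`SpineGivenEndpointR11` — the route module's glue `YMDAG.UVSplit.B5_at_record` (`ForSmallCouplings.and`, modus ponens per string, `stringHybridNE7_of_spineDatum`) at
`Rec := Node00.IsRecordOfRecord₁₁C F 2`, then §1.  Both cluster statements are HYPOTHESES (0∕1 today); `Inputs` parametric. [bookkeeping] -/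
theorem spineGivenEndpointR11_of_spineRates_spineMatching (h4 : SpineRates (fun F D w => Node00.IsRecordOfRecord₁₁C F 2 D w) Inputs)
    (h5 : SpineMatching (fun F D w => Node00.IsRecordOfRecord₁₁C F 2 D w) Inputs) : SpineGivenEndpointR11 :=
  spineGivenEndpointR11_of_spine_rec11C (B5_at_record _ Inputs h4 h5)

/-- **THE ITEM FROM THE ROUTE MODULE'S VERBATIM K5 STUB LIST** (`N = 2`; rev-0 shape with N19 as `S_N19 SRec Inputs` reading `S.δ` and U4′ `S_U4 SRec` asked): `S_N27x ₁₁C SRec` ·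
`S_N20 SRec` · `S_N21 SRec` · `S_N19 SRec Inputs` · `S_U4 SRec` ⇒ K5 (`YMDAG.UVSplit.SpineMatching_of`), and with K4's hook the item (`B5_at_record`).  The rev-1 shape without U4′
is §2's `spineGivenEndpointR11_of_rateStubs_coreEdge`. [bookkeeping] -/
theorem spineGivenEndpointR11_of_K5stubs (hx : S_N27x (fun F D w => Node00.IsRecordOfRecord₁₁C F 2 D w) SRec) (h20 : S_N20 SRec) (h21 : S_N21 SRec)
    (h19 : S_N19 SRec Inputs) (hU4 : S_U4 SRec) (h4 : SpineRates (fun F D w => Node00.IsRecordOfRecord₁₁C F 2 D w) Inputs) :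
    SpineGivenEndpointR11 :=
  spineGivenEndpointR11_of_spineRates_spineMatching Inputs h4 (SpineMatching_of _ SRec Inputs hx h20 h21 h19 hU4)

end ClusterLevel

/-! ## §5 (v1.2, append-only) THE ITEM KEYED AT NODE 00's STAGE-11 TUPLES (module XXII by name): worlds eliminated; the children's estimates read off `(θ, hP)` -/

section KeyedItem

open T4WeightBudget (RelWeightBound)
open T4IndicatorShell (ShellWeightBound)
open T4ContinuumYM4Torus (ForSmallCouplings)
open Node00 (Stage11Params datumOfRecord₁₁)

/-- **THE ITEM K3 ⟺ «B5 AT EVERY STAGE-11 DATUM OF RECORD OF `SU(2)` DATA»**: `SpineGivenEndpointR11 ↔ ∀ F (θ : Stage11Params F 2) (hP : θ.Provisos₁₁), θ.Admissible →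
HybridNE7Under (datumOfRecord₁₁ F 2 θ hP) END` — no world, no record predicate: the item is a statement about NODE 00's parameter tuples with provisos
(§1 ∘ XXII `spine_rec11C_iff_forall_datumOfRecord₁₁`). [bookkeeping] -/
theorem spineGivenEndpointR11_iff_forall_datumOfRecord₁₁ :
    SpineGivenEndpointR11 ↔ ∀ (F : T4Family) (θ : Stage11Params F 2) (hP : θ.Provisos₁₁), θ.Admissible →
      T4ApexHybrid.HybridNE7Under (datumOfRecord₁₁ F 2 θ hP) (DagBinding.EndpointExistence (datumOfRecord₁₁ F 2 θ hP).C.toB12) :=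
  spineGivenEndpointR11_iff_spine_rec11C.trans spine_rec11C_iff_forall_datumOfRecord₁₁

variable (cr : (F : T4Family) → (θ : Stage11Params F 2) → θ.Provisos₁₁ → (ℕ → ℝ) → List (ULoop F) → SpineCarriers)
  (rr : (F : T4Family) → (θ : Stage11Params F 2) → θ.Provisos₁₁ → (ℕ → ℝ) → List (ULoop F) → RateCarriers 2)

/-- **THE ITEM FROM THE CHILDREN'S ESTIMATES KEYED AT THE STAGE-11 TUPLES** (`N = 2`; XXII `spine_rec11C_of_keyed₁₁` ∘ §1): for readings `cr` (spine carriers, n20-e's type) and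
`rr` (rate carriers) off `(θ, hP)` — N20 `RelWeightBound` and N21 `ShellWeightBound` at `cr F θ hP g₀ os`, K4's six rates jointly at `rr F θ hP g₀ os` on the datum of record, the
N19′ ∃δ-edge coupling them at the SAME tuple, and the keyed extraction clause (positivity + E1∕E2 under (B), END and the small-coupling prefix) for EVERY admissible `θ` with
provisos ⇒ `SpineGivenEndpointR11`.  Every hypothesis 0∕1 today; `cr`, `rr` PARAMETERS (no readings of record in the tree). [bookkeeping] -/
theorem spineGivenEndpointR11_of_keyed₁₁
    (h20 : ∀ (F : T4Family) (θ : Stage11Params F 2) (hP : θ.Provisos₁₁), θ.Admissible → ∀ (g₀ : ℕ → ℝ) (os : List (ULoop F)),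
      RelWeightBound (cr F θ hP g₀ os).l₀ (cr F θ hP g₀ os).T (cr F θ hP g₀ os).A (cr F θ hP g₀ os).B (cr F θ hP g₀ os).Bad (cr F θ hP g₀ os).W)
    (h21 : ∀ (F : T4Family) (θ : Stage11Params F 2) (hP : θ.Provisos₁₁), θ.Admissible → ∀ (g₀ : ℕ → ℝ) (os : List (ULoop F)),
      ShellWeightBound (cr F θ hP g₀ os).l₀ (cr F θ hP g₀ os).T (cr F θ hP g₀ os).A (cr F θ hP g₀ os).B (cr F θ hP g₀ os).shA (cr F θ hP g₀ os).shB
        (cr F θ hP g₀ os).Wsh)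
    (hrates : ∀ (F : T4Family) (θ : Stage11Params F 2) (hP : θ.Provisos₁₁), θ.Admissible → ∀ (g₀ : ℕ → ℝ) (os : List (ULoop F)),
      RatesAt (datumOfRecord₁₁ F 2 θ hP) (rr F θ hP g₀ os))
    (h19 : ∀ (F : T4Family) (θ : Stage11Params F 2) (hP : θ.Provisos₁₁), θ.Admissible → ∀ (g₀ : ℕ → ℝ) (os : List (ULoop F)),
      RatesAt (datumOfRecord₁₁ F 2 θ hP) (rr F θ hP g₀ os) → letI := (cr F θ hP g₀ os).dec
        ∃ δ : ℕ → ℝ, NE7.Core (cr F θ hP g₀ os).l₀ (cr F θ hP g₀ os).vol (cr F θ hP g₀ os).T (cr F θ hP g₀ os).Bad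
          (fun K t τ => (cr F θ hP g₀ os).A K t τ - (cr F θ hP g₀ os).shA K t τ) (fun K t τ => (cr F θ hP g₀ os).B K t τ - (cr F θ hP g₀ os).shB K t τ) δ ∧
          Summable δ)
    (hx : ∀ (F : T4Family) (θ : Stage11Params F 2) (hP : θ.Provisos₁₁), θ.Admissible →
      B16.EndStatementBPrinted (datumOfRecord₁₁ F 2 θ hP).C → DagBinding.EndpointExistence (datumOfRecord₁₁ F 2 θ hP).C.toB12 →
        ForSmallCouplings (datumOfRecord₁₁ F 2 θ hP) fun g₀ => ∀ os : List (ULoop F),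
          0 < (cr F θ hP g₀ os).l₀ ∧ 0 < (cr F θ hP g₀ os).vol ∧
          (∀ (K : ℕ) (t : ℝ), |t| ≤ (cr F θ hP g₀ os).l₀ →
            T4GenFunBounds.schemeZ ((datumOfRecord₁₁ F 2 θ hP).scheme g₀) os ((cr F θ hP g₀ os).K₀ + K) t =
              ∑ τ ∈ (cr F θ hP g₀ os).T K, (cr F θ hP g₀ os).A K t τ) ∧
          (∀ (K : ℕ) (t : ℝ), |t| ≤ (cr F θ hP g₀ os).l₀ →
            T4GenFunBounds.schemeZ ((datumOfRecord₁₁ F 2 θ hP).scheme g₀) os ((cr F θ hP g₀ os).K₀ + K + 1) t =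
              ∑ τ ∈ (cr F θ hP g₀ os).T K, (cr F θ hP g₀ os).B K t τ)) :
    SpineGivenEndpointR11 :=
  spineGivenEndpointR11_of_spine_rec11C (spine_rec11C_of_keyed₁₁ cr rr h20 h21 hrates h19 hx)

end KeyedItem

/-! ## §6 (v1.3, append-only) THE TWO-KEY JUNCTION AT `N = 2` (module XXII §4 by name) -/

section TwoKeysItem

open Node00 (Stage11Params datumOfRecord₁₁)

variable (SRec : SpineRecordPred 2) (RRec : RateRecordPred 2)
  (cr : (F : T4Family) → (θ : Stage11Params F 2) → θ.Provisos₁₁ → (ℕ → ℝ) → List (ULoop F) → SpineCarriers)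
  (rr : (F : T4Family) → (θ : Stage11Params F 2) → θ.Provisos₁₁ → (ℕ → ℝ) → List (ULoop F) → RateCarriers 2)

/-- **THE ITEM FROM THE DIVIDED RATE-RECORD HOME** (`N = 2`; XXII `spine_rec11C_of_rateStubs_twoKeys₁₁` ∘ §1): for a spine-carrier record `SRec` characterised by the key `cr` ((T-SPINE)'s
`SRec₁₁`, `hkeyS`) and a rate-carrier record `RRec` characterised by the key `rr` ((T-RATE)'s `RRec₁₁`, `hkeyR`) — the K4 stubs `S_R00x ₁₁C RRec`, `S_N14`–`S_N18`, `S_N22` at `RRec`,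
the K5 stubs `S_N27x ₁₁C SRec`, `S_N20`, `S_N21` at `SRec` (the home modules' one-application instances of the children's keyed estimates) and the N19′ edge for EVERY PAIR of tuples
realising the same datum (`h19₂`) give `SpineGivenEndpointR11`.  Every stub a HYPOTHESIS (0∕1 today). [bookkeeping] -/
theorem spineGivenEndpointR11_of_rateStubs_twoKeys₁₁
    (hkeyS : ∀ (F : T4Family) (D : Datum F 2) (g₀ : ℕ → ℝ) (os : List (ULoop F)) (S : SpineCarriers), SRec F D g₀ os S ↔
      ∃ (θ : Stage11Params F 2) (hP : θ.Provisos₁₁), θ.Admissible ∧ D = datumOfRecord₁₁ F 2 θ hP ∧ S = cr F θ hP g₀ os)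
    (hkeyR : ∀ (F : T4Family) (D : Datum F 2) (g₀ : ℕ → ℝ) (os : List (ULoop F)) (R : RateCarriers 2), RRec F D g₀ os R ↔
      ∃ (θ : Stage11Params F 2) (hP : θ.Provisos₁₁), θ.Admissible ∧ D = datumOfRecord₁₁ F 2 θ hP ∧ R = rr F θ hP g₀ os)
    (hx : S_R00x (fun F D w => Node00.IsRecordOfRecord₁₁C F 2 D w) RRec) (h14 : S_N14 RRec) (h15 : S_N15 RRec) (h16 : S_N16 RRec) (h17 : S_N17 RRec)
    (h18 : S_N18 RRec) (h22 : S_N22 RRec) (hx' : S_N27x (fun F D w => Node00.IsRecordOfRecord₁₁C F 2 D w) SRec) (h20 : S_N20 SRec) (h21 : S_N21 SRec)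
    (h19₂ : ∀ (F : T4Family) (θ : Stage11Params F 2) (hP : θ.Provisos₁₁) (θ' : Stage11Params F 2) (hP' : θ'.Provisos₁₁), θ.Admissible → θ'.Admissible →
      datumOfRecord₁₁ F 2 θ' hP' = datumOfRecord₁₁ F 2 θ hP → ∀ (g₀ : ℕ → ℝ) (os : List (ULoop F)),
        RatesAt (datumOfRecord₁₁ F 2 θ hP) (rr F θ' hP' g₀ os) → letI := (cr F θ hP g₀ os).dec
          ∃ δ : ℕ → ℝ, NE7.Core (cr F θ hP g₀ os).l₀ (cr F θ hP g₀ os).vol (cr F θ hP g₀ os).T (cr F θ hP g₀ os).Bad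
            (fun K t τ => (cr F θ hP g₀ os).A K t τ - (cr F θ hP g₀ os).shA K t τ) (fun K t τ => (cr F θ hP g₀ os).B K t τ - (cr F θ hP g₀ os).shB K t τ) δ ∧
            Summable δ) :
    SpineGivenEndpointR11 :=
  spineGivenEndpointR11_of_spine_rec11C (spine_rec11C_of_rateStubs_twoKeys₁₁ SRec RRec cr rr hkeyS hkeyR hx h14 h15 h16 h17 h18 h22 hx' h20 h21 h19₂)

end TwoKeysItem

end Summit.QuantumFields.YangMills.Theorems.BalabanUVNodesN27SpineRecord
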